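import Summits.QuantumFields.YangMills.Theorems.LuscherReductionTwistedTraceScalingBOGaugeAvgChart
import Summits.QuantumFields.YangMills.Theorems.LuscherReductionTwistedTraceScalingFPWeightLaplace
import HarnessLib

/-!
# (C1c'-ε) ★★★ THE FADDEEV–POPOV WEIGHT WITH A RIDER: `gaugeAvg (χ·R)(U*) ∈ [r₋·(N(U*) − T), r₊·N(U*) + R_max·T]` at a slice tube point, `T` an explicit Gaussian tail
# (lane A of S-BASE, crux `TwistedTraceScaling` stmt-QuantumFields-20203, C4-CORE, the (OD) pen, steps (2)+(3) of the (C1c') plan, `pub/ym-fleet/ym-luscher-20007-p1/COARSE-DESIGN.md` §28.4)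

(P) with a rider, WITHOUT re-running the Laplace method.  Under EXACTLY the hypotheses of `…FPWeightLaplace.fpWeight_laplace_bounds` (slice tube point `U* = tubePt p`, gauge width `s`, core
radius `r`, support radius `R₁`, Taylor/coercivity constants of the (N2) tool-chain) and for a bounded measurable colour-invariant rider `0 ≤ R ≤ R_max` which on the chart core `‖w‖ ≤ r` stays
in `[r₋, r₊]` along the based orbit of `U*`:
★★★ `gaugeAvg_rider_sandwich`:  `r₋·(N(U*) − T) ≤ gaugeAvg (recordWeightRho · R) (U*) ≤ r₊·N(U*) + R_max·T`,  `N = gaugeAvg recordWeightRho`,  `T = (2π²)^{−n}·e^{−c²r²/(4s²)}·I(1/4)`,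
`I(a) = ∫ exp(−a‖Aw‖²/s²) dw` (the same Gaussian that bounds the tail of `fpWeight_laplace_bounds`; `I(1/4)/N(U*) = O(4^{3n/2})` by `…FPWeightExplicit`).
Mechanism: `gaugeAvg (χ·R)(U*) = ∫ dens·fpIntegrand·R dw` (`…BOGaugeAvgChart.gaugeAvg_eq_integral_basedChart`), `N(U*) = ∫ dens·fpIntegrand dw` (`gaugeAvg_eq_integral_fpIntegrand`), the
off-core envelope `fpIntegrand ≤ e^{−‖Aw‖²/(2s²)}` and coercivity `c‖w‖ ≤ ‖Aw‖` (`fpIntegrand_envelope_hyps`) give `∫_{‖w‖>r} dens·fpIntegrand ≤ T`, and `integral_mul_rider_sandwich_of_tail`.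
★ `rider_exp_core_bounds` — the core bounds for the rider factor `e^{−q(relLinkVec ·)}`: along the based orbit, `relLinkVec(U*^{P∘ξ}) = fB(ξ,p) = linkEmbed p.1 + basedLin p ξ + O(M‖ξ‖²)`
(`hT`), so `|q(fB(gnoParam w, p)) − q(linkEmbed p.1)| ≤ (96t+b)·D·(2‖linkEmbed p.1‖ + D)`, `D = ‖basedLin p‖·r + M·r²` — NO gauge-mode cancellation is needed because the Gaussian core radius
`r = s·polylog = β^{-1}·polylog` is far below the fibre scale.
So (C1c') step (2) is reduced to the INDICATOR facts on the core (`U*^{P∘ξ}` stays in the orthographic tube, its slow mean in the window, `‖fB‖ ≤ r_B`) — (C4)-type bookkeeping.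
HONEST FRAMING: bookkeeping around the landed (N2) Laplace chain for a stub of a child of the CONDITIONAL route R2b1; (C1c') indicators/(5), (C4), (C5), (B-ST) OPEN; C4-CORE OPEN; not infinite
volume, not a gap, not Clay.
-/

set_option autoImplicit false

noncomputable section

open MeasureTheory Real
open scoped BigOperators RealInnerProductSpace
open Literature.MathematicalPhysics.QuantumFieldTheory
open Literature.MathematicalPhysics.QuantumLattice

namespace Summit.QuantumFields.YangMills.Theorems.FemtoTransferGap.TwoLattice.ConstTube

open Summit.QuantumFields.YangMills.Theorems.FemtoTransferGap
open Summit.QuantumFields.YangMills.Theorems.FemtoTransferGap.TwoLattice.Avg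
open Summit.QuantumFields.YangMills.Theorems.FemtoTransferGap.TwoLattice.Stiff (LinkSpace stiffHessian)
open Summit.QuantumFields.YangMills.Theorems.FemtoTransferGap.TwoLattice.GnChart
open Literature.MathematicalPhysics.QuantumFieldTheory.Balaban1983to89.T4CubeChartGnomonic (gnoPoint)

variable (L : ℕ) [NeZero L]

/-! ## §1 ★★★ The Faddeev–Popov weight with a rider -/

/-- ★★★ **THE FADDEEV–POPOV WEIGHT WITH A RIDER** (see the module docstring).  Hypotheses up to `hθ` are literally those of `fpWeight_laplace_bounds`; then the rider data. [cite: Luscher1983, §3] -/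
theorem gaugeAvg_rider_sandwich (hL : Nonempty (NzSite L)) {δ ρ δg : ℝ → ℝ} {β : ℝ} (hs : 0 < δg β)
    (p : balancedSubmodule L × (Fin 3 → Fin 3 → ℝ))
    {εT M : ℝ} (hM0 : 0 ≤ M) (hεT : 0 < εT)
    (hT : ∀ (ξ : basedSubmodule L) (q : balancedSubmodule L × (Fin 3 → Fin 3 → ℝ)), ‖ξ‖ < εT → ‖q‖ < εT →
      ‖basedFn L (ξ, q) - basedFn L (0, q) - basedLin L q ξ‖ ≤ M * ‖ξ‖ ^ 2)
    {εC : ℝ} (hC : ∀ q : balancedSubmodule L × (Fin 3 → Fin 3 → ℝ), ‖q‖ < εC →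
      ∀ ξ : basedSubmodule L, ‖ξ‖ ≤ 4 * sliceConst L * ‖(gaugeModes L).starProjection (basedLin L q ξ)‖)
    (hpT : ‖p‖ < εT) (hpC : ‖p‖ < εC) (hp40 : ‖p‖ ≤ 1 / 40)
    (hslice : (gaugeModes L).starProjection (linkEmbed L (p.1 : Edge 3 L → Fin 3 → ℝ)) = 0)
    {ρ₁ : ℝ} (hU : tubePt L p ∈ fatTubeRho L δ (fun _ => ρ₁) β)
    {r R₁ : ℝ} (hr0 : 0 ≤ r) (hrR : r ≤ R₁) (hR1 : R₁ ≤ 1 / 2) (hR1T : R₁ < εT) (hcore : ρ₁ + 8 * r ≤ ρ β)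
    (hsupp : 3 * ((L : ℝ) - 1) * (ρ₁ + ρ β) ≤ R₁)
    (hθ : (M + 2 * ‖basedLin L p‖) * R₁ * (4 * sliceConst L) ≤ 1 / 4)
    -- the rider
    {Rf : GaugeConfig 3 L SU2 → ℝ} (hRm : Measurable Rf) {Rmax : ℝ} (hR0 : ∀ U, 0 ≤ Rf U) (hRmax : ∀ U, Rf U ≤ Rmax)
    (hRinv : ∀ (c : SU2) (U : GaugeConfig 3 L SU2), Rf (gaugeTransform (fun _ : Site 3 L => c) U) = Rf U)
    {rlo rhi : ℝ} (hrlo : 0 ≤ rlo) (hrhi : 0 ≤ rhi)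
    (hRcore : ∀ w : NzSite L → Fin 3 → ℝ, ‖w‖ ≤ r → rlo ≤ Rf (gaugeTransform (basedExt L fun y => gnoPoint (w y)) (tubePt L p)) ∧
      Rf (gaugeTransform (basedExt L fun y => gnoPoint (w y)) (tubePt L p)) ≤ rhi) :
    let n := Fintype.card (NzSite L)
    let s := δg β
    let c := 1 / (4 * sliceConst L)
    let T := ((2 * π ^ 2)⁻¹) ^ n * (Real.exp (-(c ^ 2 * r ^ 2 / (4 * s ^ 2))) * ∫ w, Real.exp (-(1 / 4 * ‖laplaceMap L p w‖ ^ 2 / s ^ 2)))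
    rlo * (gaugeAvg (recordWeightRho L δ ρ δg β) (tubePt L p) - T) ≤ gaugeAvg (fun U => recordWeightRho L δ ρ δg β U * Rf U) (tubePt L p) ∧
      gaugeAvg (fun U => recordWeightRho L δ ρ δg β U * Rf U) (tubePt L p) ≤ rhi * gaugeAvg (recordWeightRho L δ ρ δg β) (tubePt L p) + Rmax * T := by
  intro n s c T
  classical
  haveI := hL
  have hCpos := sliceConst_pos L
  have hc0 : 0 < c := by show 0 < 1 / (4 * sliceConst L); positivity
  have hM'0 : 0 ≤ (M + 2 * ‖basedLin L p‖) := by positivity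
  have hU1 : tubePt L p ∈ nearOne L ρ₁ := hU.1
  have hRmax0 : 0 ≤ Rmax := (hR0 (tubePt L p)).trans (hRmax _)
  obtain ⟨hcoer, hcoreB, hoffB, hsupp0⟩ := fpIntegrand_envelope_hyps L hL hs p hM0 hεT hT hC hpT hpC hp40 hslice hU hr0 hrR hR1 hR1T hcore hsupp hθ
  have hG0 : ∀ w, 0 ≤ fpIntegrand L δ ρ δg β p w := fun w => (fpIntegrand_mem_Icc L δ ρ δg β p w).1
  set η : ℝ := 3 * ((M + 2 * ‖basedLin L p‖) * r * (4 * sliceConst L)) with hη_def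
  have hθr4 : (M + 2 * ‖basedLin L p‖) * r * (4 * sliceConst L) ≤ 1 / 4 :=
    (mul_le_mul_of_nonneg_right (mul_le_mul_of_nonneg_left hrR hM'0) (by positivity)).trans hθ
  have hη0 : 0 ≤ η := by rw [hη_def]; positivity
  have hηlt : η < 1 := by rw [hη_def]; linarith
  -- integrability of the chart integrand (as in `fpWeight_laplace_bounds`)
  have hI : ∀ a : ℝ, 0 < a → Integrable (fun w : NzSite L → Fin 3 → ℝ => Real.exp (-(a * ‖laplaceMap L p w‖ ^ 2 / s ^ 2))) := fun a ha =>
    integrable_exp_neg_quad (laplaceMap L p) hc0 hs ha hcoer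
  have hGint : Integrable (fpIntegrand L δ ρ δg β p) := by
    have hup := laplace_upper_envelope (laplaceMap L p) (c := c) (s := s) (r := r) (η := η) (G := fpIntegrand L δ ρ δg β p) hc0 hr0 hcoer hcoreB hoffB
    have hUi : Integrable (fun w : NzSite L → Fin 3 → ℝ => Real.exp (-((1 - η) * ‖laplaceMap L p w‖ ^ 2 / s ^ 2)) +
        Real.exp (-(c ^ 2 * r ^ 2 / (4 * s ^ 2))) * Real.exp (-(1 / 4 * ‖laplaceMap L p w‖ ^ 2 / s ^ 2))) :=
      (hI (1 - η) (sub_pos.mpr hηlt)).add ((hI (1 / 4) (by norm_num)).const_mul (Real.exp (-(c ^ 2 * r ^ 2 / (4 * s ^ 2)))))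
    have hbound : ∀ w : NzSite L → Fin 3 → ℝ, ‖fpIntegrand L δ ρ δg β p w‖ ≤ Real.exp (-((1 - η) * ‖laplaceMap L p w‖ ^ 2 / s ^ 2)) +
        Real.exp (-(c ^ 2 * r ^ 2 / (4 * s ^ 2))) * Real.exp (-(1 / 4 * ‖laplaceMap L p w‖ ^ 2 / s ^ 2)) := fun w => by
      have h1 : ‖fpIntegrand L δ ρ δg β p w‖ = fpIntegrand L δ ρ δg β p w := Real.norm_of_nonneg (hG0 w)
      exact h1.le.trans (hup w)
    exact hUi.mono' (measurable_fpIntegrand L δ ρ δg β p).aestronglyMeasurable (ae_of_all _ hbound)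
  have hb2 : ∀ w : NzSite L → Fin 3 → ℝ, ‖piGnDensityReal (NzSite L) w * fpIntegrand L δ ρ δg β p w‖ ≤ ((2 * π ^ 2)⁻¹) ^ n * fpIntegrand L δ ρ δg β p w :=
    fun w => by
      obtain ⟨hd0, hd1⟩ := piGnDensityReal_pos_le (NzSite L) w
      have e : ‖piGnDensityReal (NzSite L) w * fpIntegrand L δ ρ δg β p w‖ = piGnDensityReal (NzSite L) w * fpIntegrand L δ ρ δg β p w :=
        Real.norm_of_nonneg (mul_nonneg hd0.le (hG0 w))
      exact e.le.trans (mul_le_mul_of_nonneg_right hd1 (hG0 w))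
  have hdens_int : Integrable fun w : NzSite L → Fin 3 → ℝ => piGnDensityReal (NzSite L) w * fpIntegrand L δ ρ δg β p w :=
    (hGint.const_mul (((2 * π ^ 2)⁻¹) ^ n)).mono' ((measurable_piGnDensityReal (NzSite L)).mul (measurable_fpIntegrand L δ ρ δg β p)).aestronglyMeasurable
      (ae_of_all _ hb2)
  -- the two chart formulas
  have hN : gaugeAvg (recordWeightRho L δ ρ δg β) (tubePt L p) = ∫ w, piGnDensityReal (NzSite L) w * fpIntegrand L δ ρ δg β p w :=
    gaugeAvg_eq_integral_fpIntegrand L p hU1 (lt_of_le_of_lt hsupp (by linarith only [hR1]))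
  set Rw : (NzSite L → Fin 3 → ℝ) → ℝ := fun w => Rf (gaugeTransform (basedExt L fun y => gnoPoint (w y)) (tubePt L p)) with hRw
  have hRwm : Measurable Rw := (measurable_comp_gaugeTransform_left hRm (tubePt L p)).comp ((measurable_basedExt L).comp (measurable_gnoLift L))
  have hφm : Measurable fun U => recordWeightRho L δ ρ δg β U * Rf U := (measurable_recordWeightRho L δ ρ δg β).mul hRm
  have hφb : ∀ U, |recordWeightRho L δ ρ δg β U * Rf U| ≤ 1 * Rmax := fun U => by
    obtain ⟨h0, h1⟩ := recordWeightRho_mem_Icc L δ ρ δg β U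
    rw [abs_mul, abs_of_nonneg h0, abs_of_nonneg (hR0 U)]; exact mul_le_mul h1 (hRmax U) (hR0 U) zero_le_one
  have hφinv : ∀ (c' : SU2) (U : GaugeConfig 3 L SU2), recordWeightRho L δ ρ δg β (gaugeTransform (fun _ : Site 3 L => c') U) * Rf (gaugeTransform (fun _ : Site 3 L => c') U) =
      recordWeightRho L δ ρ δg β U * Rf U := fun c' U => by rw [recordWeightRho_conj, hRinv]
  have hφsupp : ∀ U, recordWeightRho L δ ρ δg β U * Rf U ≠ 0 → U ∈ nearOne L (ρ β) := fun U hU' => by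
    have h1 : recordWeightRho L δ ρ δg β U ≠ 0 := left_ne_zero_of_mul hU'
    by_contra hnot
    apply h1
    unfold recordWeightRho
    rw [Set.indicator_of_notMem (fun h => hnot h.1), zero_mul]
  have hA : gaugeAvg (fun U => recordWeightRho L δ ρ δg β U * Rf U) (tubePt L p) = ∫ w, piGnDensityReal (NzSite L) w * fpIntegrand L δ ρ δg β p w * Rw w := by
    rw [gaugeAvg_eq_integral_basedChart L hφm hφb hφinv hφsupp p hU1 (lt_of_le_of_lt hsupp (by linarith only [hR1]))]
    refine integral_congr_ae (ae_of_all _ fun w => ?_)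
    show piGnDensityReal (NzSite L) w * (recordWeightRho L δ ρ δg β (gaugeTransform (basedExt L fun y => gnoPoint (w y)) (tubePt L p)) *
      Rf (gaugeTransform (basedExt L fun y => gnoPoint (w y)) (tubePt L p))) = piGnDensityReal (NzSite L) w * fpIntegrand L δ ρ δg β p w * Rw w
    rw [hRw, mul_assoc]; rfl
  -- the tail `∫ 𝟙_{‖w‖>r} dens·fpIntegrand ≤ T`
  set a : (NzSite L → Fin 3 → ℝ) → ℝ := fun w => piGnDensityReal (NzSite L) w * fpIntegrand L δ ρ δg β p w with ha
  have ha0 : ∀ w, 0 ≤ a w := fun w => mul_nonneg (piGnDensityReal_pos_le (NzSite L) w).1.le (hG0 w)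
  have hball : MeasurableSet {w : NzSite L → Fin 3 → ℝ | ‖w‖ ≤ r} := measurableSet_le measurable_norm measurable_const
  have htail : ∫ w, {w : NzSite L → Fin 3 → ℝ | ‖w‖ ≤ r}ᶜ.indicator a w ≤ T := by
    have hpt : ∀ w, {w : NzSite L → Fin 3 → ℝ | ‖w‖ ≤ r}ᶜ.indicator a w ≤
        ((2 * π ^ 2)⁻¹) ^ n * (Real.exp (-(c ^ 2 * r ^ 2 / (4 * s ^ 2))) * Real.exp (-(1 / 4 * ‖laplaceMap L p w‖ ^ 2 / s ^ 2))) := fun w => by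
      by_cases hw : w ∈ {w : NzSite L → Fin 3 → ℝ | ‖w‖ ≤ r}ᶜ
      · rw [Set.indicator_of_mem hw, ha]
        have hw' : r < ‖w‖ := not_le.1 hw
        have h1 := hoffB w hw'
        have hcw := hcoer w
        -- `‖Aw‖²/(2s²) ≥ ‖Aw‖²/(4s²) + c²r²/(4s²)`
        have hcr : c * r ≤ ‖laplaceMap L p w‖ := (mul_le_mul_of_nonneg_left hw'.le hc0.le).trans hcw
        have hcr2 : c ^ 2 * r ^ 2 ≤ ‖laplaceMap L p w‖ ^ 2 := by rw [← mul_pow]; exact pow_le_pow_left₀ (by positivity) hcr 2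
        have h2 : Real.exp (-(‖laplaceMap L p w‖ ^ 2 / (2 * s ^ 2))) ≤ Real.exp (-(c ^ 2 * r ^ 2 / (4 * s ^ 2))) * Real.exp (-(1 / 4 * ‖laplaceMap L p w‖ ^ 2 / s ^ 2)) := by
          rw [← Real.exp_add]; refine Real.exp_le_exp.2 ?_
          have hs2 : 0 < s ^ 2 := by positivity
          have e1 : -(‖laplaceMap L p w‖ ^ 2 / (2 * s ^ 2)) = (-(‖laplaceMap L p w‖ ^ 2 / 2)) / s ^ 2 := by ring
          have e2 : -(c ^ 2 * r ^ 2 / (4 * s ^ 2)) + -(1 / 4 * ‖laplaceMap L p w‖ ^ 2 / s ^ 2) = (-(c ^ 2 * r ^ 2 / 4) - 1 / 4 * ‖laplaceMap L p w‖ ^ 2) / s ^ 2 := by ring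
          rw [e1, e2, div_le_div_iff_of_pos_right hs2]
          nlinarith
        calc piGnDensityReal (NzSite L) w * fpIntegrand L δ ρ δg β p w ≤ ((2 * π ^ 2)⁻¹) ^ n * Real.exp (-(‖laplaceMap L p w‖ ^ 2 / (2 * s ^ 2))) :=
              mul_le_mul (piGnDensityReal_pos_le (NzSite L) w).2 h1 (hG0 w) (by positivity)
          _ ≤ _ := mul_le_mul_of_nonneg_left h2 (by positivity)
      · rw [Set.indicator_of_notMem hw]; positivity
    have hTi : Integrable (fun w : NzSite L → Fin 3 → ℝ => ((2 * π ^ 2)⁻¹) ^ n * (Real.exp (-(c ^ 2 * r ^ 2 / (4 * s ^ 2))) * Real.exp (-(1 / 4 * ‖laplaceMap L p w‖ ^ 2 / s ^ 2)))) :=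
      (((hI (1 / 4) (by norm_num)).const_mul _).const_mul _)
    calc _ ≤ ∫ w, ((2 * π ^ 2)⁻¹) ^ n * (Real.exp (-(c ^ 2 * r ^ 2 / (4 * s ^ 2))) * Real.exp (-(1 / 4 * ‖laplaceMap L p w‖ ^ 2 / s ^ 2))) :=
          integral_mono (hdens_int.indicator hball.compl) hTi hpt
      _ = T := by rw [integral_const_mul, integral_const_mul]
  -- integrability of `a·Rw`
  have hari : Integrable (fun w => a w * Rw w) := Integrable.mono' (hdens_int.const_mul Rmax) ((((measurable_piGnDensityReal (NzSite L)).mul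
      (measurable_fpIntegrand L δ ρ δg β p))).mul hRwm).aestronglyMeasurable (ae_of_all _ fun w => by
    rw [Real.norm_eq_abs, abs_mul, abs_of_nonneg (ha0 w), abs_of_nonneg (hR0 _)]
    calc a w * Rw w ≤ a w * Rmax := mul_le_mul_of_nonneg_left (hRmax _) (ha0 w)
      _ = Rmax * a w := mul_comm _ _)
  -- the sandwich
  have hsand := integral_mul_rider_sandwich_of_tail (μ := volume) ha0 hRmax0 (fun w => hR0 _) (fun w => hRmax _) hball hrlo hrhi (fun w hw => hRcore w hw) htail hdens_int hari
  rw [hN, hA]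
  simpa only [ha] using hsand

variable {L}

/-! ## §2 The core bounds for the rider factor `e^{−q(relLinkVec ·)}` -/

/-- ★ **Core bounds for the stiff rider**: along the based orbit of the tube point, for `‖w‖ ≤ r` (`r < ε_T`, `‖p‖ < ε_T`, `‖p‖ ≤ 1/40`),
`|q(relLinkVec (U*^{basedExt(gno∘w)})) − q(linkEmbed p.1)| ≤ (96t+b)·D·(2‖linkEmbed p.1‖ + D)`, `D = ‖basedLin p‖·r + M·r²`, hence
`e^{−q(linkEmbed p.1)}·e^{−(96t+b)D(2‖x*‖+D)} ≤ e^{−q(relLinkVec (U*^{basedExt(gno∘w)}))} ≤ e^{−q(linkEmbed p.1)}·e^{(96t+b)D(2‖x*‖+D)}`. [folklore] -/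
theorem rider_exp_core_bounds {t : ℝ} (ht : 0 ≤ t) {b : ℝ} (hb : 0 ≤ b) (p : balancedSubmodule L × (Fin 3 → Fin 3 → ℝ))
    {εT M : ℝ} (hM0 : 0 ≤ M)
    (hT : ∀ (ξ : basedSubmodule L) (q : balancedSubmodule L × (Fin 3 → Fin 3 → ℝ)), ‖ξ‖ < εT → ‖q‖ < εT →
      ‖basedFn L (ξ, q) - basedFn L (0, q) - basedLin L q ξ‖ ≤ M * ‖ξ‖ ^ 2)
    (hpT : ‖p‖ < εT) (hp40 : ‖p‖ ≤ 1 / 40) {r : ℝ} (hrT : r < εT) {w : NzSite L → Fin 3 → ℝ} (hw : ‖w‖ ≤ r) :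
    let D := ‖basedLin L p‖ * r + M * r ^ 2
    let ε := (96 * t + b) * D * (2 * ‖linkEmbed L (p.1 : Edge 3 L → Fin 3 → ℝ)‖ + D)
    |stiffGaussExp L t b (relLinkVec L (gaugeTransform (basedExt L fun y => gnoPoint (w y)) (tubePt L p))) - stiffGaussExp L t b (linkEmbed L (p.1 : Edge 3 L → Fin 3 → ℝ))| ≤ ε ∧
      Real.exp (-stiffGaussExp L t b (linkEmbed L (p.1 : Edge 3 L → Fin 3 → ℝ))) * Real.exp (-ε) ≤
        Real.exp (-stiffGaussExp L t b (relLinkVec L (gaugeTransform (basedExt L fun y => gnoPoint (w y)) (tubePt L p)))) ∧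
      Real.exp (-stiffGaussExp L t b (relLinkVec L (gaugeTransform (basedExt L fun y => gnoPoint (w y)) (tubePt L p)))) ≤
        Real.exp (-stiffGaussExp L t b (linkEmbed L (p.1 : Edge 3 L → Fin 3 → ℝ))) * Real.exp ε := by
  intro D ε
  set ξ := gnoParam L w with hξ
  set x' : LinkSpace L := linkEmbed L (p.1 : Edge 3 L → Fin 3 → ℝ) with hx'
  have hξr : ‖ξ‖ ≤ r := (norm_gnoParam_le L w).trans hw
  have hξT : ‖ξ‖ < εT := lt_of_le_of_lt hξr hrT
  have hp1 : ‖p.1‖ ≤ 1 / 20 := (norm_fst_le p).trans (by linarith)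
  have hp2 : ‖p.2‖ ≤ 1 / 40 := (norm_snd_le p).trans hp40
  have hfB0 : basedFn L (0, p) = x' := basedFn_zero_left L p hp1 hp2
  have hx : relLinkVec L (gaugeTransform (basedExt L fun y => gnoPoint (w y)) (tubePt L p)) = basedFn L (ξ, p) := by
    rw [basedExt_gno_eq, relLinkVec_gaugeTransform_tubePt]
  -- `‖fB(ξ,p) − x'‖ ≤ D`
  have hdiff : ‖basedFn L (ξ, p) - x'‖ ≤ D := by
    have h1 := hT ξ p hξT hpT
    rw [hfB0] at h1
    have h2 : ‖basedLin L p ξ‖ ≤ ‖basedLin L p‖ * r := (ContinuousLinearMap.le_opNorm _ _).trans (mul_le_mul_of_nonneg_left hξr (norm_nonneg _))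
    have h3 : M * ‖ξ‖ ^ 2 ≤ M * r ^ 2 := mul_le_mul_of_nonneg_left (pow_le_pow_left₀ (norm_nonneg _) hξr 2) hM0
    calc ‖basedFn L (ξ, p) - x'‖ = ‖(basedFn L (ξ, p) - x' - basedLin L p ξ) + basedLin L p ξ‖ := by rw [sub_add_cancel]
      _ ≤ ‖basedFn L (ξ, p) - x' - basedLin L p ξ‖ + ‖basedLin L p ξ‖ := norm_add_le _ _
      _ ≤ M * r ^ 2 + ‖basedLin L p‖ * r := add_le_add (h1.trans h3) h2
      _ = D := by show M * r ^ 2 + ‖basedLin L p‖ * r = ‖basedLin L p‖ * r + M * r ^ 2; ring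
  have hD0 : 0 ≤ D := (norm_nonneg _).trans hdiff
  have hsum : ‖basedFn L (ξ, p) + x'‖ ≤ 2 * ‖x'‖ + D := by
    calc ‖basedFn L (ξ, p) + x'‖ = ‖(basedFn L (ξ, p) - x') + (2 : ℝ) • x'‖ := by rw [two_smul]; abel_nf
      _ ≤ ‖basedFn L (ξ, p) - x'‖ + ‖(2 : ℝ) • x'‖ := norm_add_le _ _
      _ ≤ D + 2 * ‖x'‖ := by rw [norm_smul, Real.norm_two]; linarith
      _ = 2 * ‖x'‖ + D := by ring
  have hq : |stiffGaussExp L t b (basedFn L (ξ, p)) - stiffGaussExp L t b x'| ≤ ε := by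
    calc _ ≤ (96 * t + b) * ‖basedFn L (ξ, p) - x'‖ * ‖basedFn L (ξ, p) + x'‖ := abs_stiffGaussExp_sub_le ht hb _ _
      _ ≤ (96 * t + b) * D * (2 * ‖x'‖ + D) := by gcongr
  rw [hx]
  refine ⟨hq, ?_, ?_⟩
  · rw [← Real.exp_add]; exact Real.exp_le_exp.2 (by linarith [(abs_le.1 hq).2])
  · rw [← Real.exp_add]; exact Real.exp_le_exp.2 (by linarith [(abs_le.1 hq).1])

end Summit.QuantumFields.YangMills.Theorems.FemtoTransferGap.TwoLattice.ConstTube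

end
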